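import Summits.QuantumFields.BalabanUV.Beta.GAN24.SoftMinimiserOneStepCubic
import Summits.QuantumFields.BalabanUV.Beta.GAN24.SavgInverseUniformHard

/-!
# G-an2-4 ∕ (CONV-C), road P2, route R2-S1 — THE HARD SCALAR MINIMISER `H = M·S⁻¹` ON CUBIC TORI: its all-sites one-step sup law MODULO
# ONE remaining interface item, (U-SINV) = the n-uniform sup → sup bounds of the unit-lattice inverses `S_N⁻¹`, `S_{RN}⁻¹`
# (`S_n = a′Q′G′_nQ′*`); every other letter supplied BY NAME (the swarm's `scalarLetters_cubic`, leaf-01's (L0) via `ScalarZerothLetterTorus.sup_Gps`)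

Unit `b2b-balaban-gan24-p2` (gen 29), BINDER row G-an2-4 ∕ (CONV-C), road P2.  `HardMinimiserOneStepSup.norm_Mhard_succ_sub_stair_le_of_letters` displays
seven binders; five are now theorems of the tree on cubic tori (the four (1.115)∕(1.112)-type letters: `ScalarSupLettersCubicHolds.scalarLetters_cubic`;
the zeroth letter: `ScalarZerothLetterTorus.sup_Gps`).  THIS FILE leaves exactly the two unit-lattice binders `hS`, `hS′` displayed — the content of
this seat's «INTERFACE REQUEST G-an2-4: (U-SINV)» (`HOME/INBOX.md` 2026-08-21T09:07Z; taken by gan24-formalise-leaf-03 gen 49, journal l.29655):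
 * **`norm_Mhard_succ_sub_stair_le_cubic_of_sinv`** — `∃ C > 0` (function of `d, a′`) such that for all `N R N₀ ≥ 1`, all `σ, σ′` with
   `|S_N⁻¹v| ≤ σ|v|`, `|S_{RN}⁻¹v| ≤ σ′|v|` (sup → sup), all `|v| ≤ V` and every fine site `x′`:
   `‖(H′v)(x′) − (Hv)(par x′)‖ ≤ C·((R−1)∕(RN))·(2 + log(RN) + log N)·σ′·(1 + C·σ)·V`.
HONEST SCOPE.  Junction only; scalar, `U = 1`, CUBIC; CONDITIONAL on (U-SINV) (two displayed binders, no named fact); NOT (CONV-C) as typed, NEVER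
«G-an2-4 closed», NOT NE2, NOT D1, NOT BetaPertH, NOT continuum, NOT Clay; not in print — our proof.  HONEST DEPENDENCY: continuum YM on T⁴ ⇐
BetaPertH ∧ nine spine estimates (0/9 proved); BetaPertH ⇐ (D1) ∧ (D4) ∧ CAP+tail; G-an2-4 gates asym, D1 and NE2/3/4.
-/

noncomputable section

open scoped BigOperators ComplexConjugate Matrix

namespace Summit.QuantumFields.BalabanUV.Beta.GAN24.HardMinimiserOneStepCubic

open Literature.MathematicalPhysics.QuantumFieldTheory.Balaban1983to89
open B5Prop11Plancherel (Tor fine)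
open Summit.QuantumFields.BalabanUV.T4Continuum.BalabanAveragedTowerModes (par)
open Summit.QuantumFields.BalabanUV.Beta.GAN24.HardMinimiserOneStepSup (Savg Mhard norm_Mhard_succ_sub_stair_le_of_letters)
open Summit.QuantumFields.BalabanUV.Beta.GAN24.ScalarSupLettersCubicHolds (scalarLetters_cubic)
open Summit.QuantumFields.BalabanUV.Beta.GAN24.ScalarZerothLetterTorus (sup_Gps)

variable (d : ℕ)

/-- **THE HARD SCALAR MINIMISER'S ALL-SITES ONE-STEP SUP LAW ON CUBIC TORI, MODULO (U-SINV) ONLY**: `∃ C(d,a′) > 0` with, for all `N R N₀ ≥ 1`, all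
sup → sup bounds `σ, σ′` of `S_N⁻¹`, `S_{RN}⁻¹`, all `|v| ≤ V`, every `x′`:
`‖(H′v)(x′) − (Hv)(par x′)‖ ≤ C·((R−1)∕(RN))·(2 + log(RN) + log N)·σ′·(1 + C·σ)·V`. [folklore] -/
theorem norm_Mhard_succ_sub_stair_le_cubic_of_sinv {a' : ℝ} (ha' : 0 < a') :
    ∃ C : ℝ, 0 < C ∧ ∀ (N R N₀ : ℕ) [NeZero N] [NeZero R] [NeZero N₀] (σ σ' : ℝ),
      (∀ (v : Tor (fun _ : Fin (d + 1) => N₀) → ℂ) (b : ℝ), (∀ y, ‖v y‖ ≤ b) →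
        ∀ y, ‖((Savg N (fun _ : Fin (d + 1) => N₀) a')⁻¹ *ᵥ v) y‖ ≤ σ * b) →
      (∀ (v : Tor (fun _ : Fin (d + 1) => N₀) → ℂ) (b : ℝ), (∀ y, ‖v y‖ ≤ b) →
        ∀ y, ‖((Savg (R * N) (fun _ : Fin (d + 1) => N₀) a')⁻¹ *ᵥ v) y‖ ≤ σ' * b) →
      ∀ (v : Tor (fun _ : Fin (d + 1) => N₀) → ℂ) (V : ℝ), (∀ y, ‖v y‖ ≤ V) →
        ∀ x : Tor (fine (R * N) (fun _ : Fin (d + 1) => N₀)),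
          ‖(Mhard (R * N) (fun _ : Fin (d + 1) => N₀) a' *ᵥ v) x
              - (Mhard N (fun _ : Fin (d + 1) => N₀) a' *ᵥ v) (par N R (fun _ : Fin (d + 1) => N₀) x)‖
            ≤ C * (((R : ℝ) - 1) / ((R : ℝ) * N)) * (2 + Real.log ((R * N : ℕ) : ℝ) + Real.log (N : ℝ))
                * σ' * (1 + C * σ) * V := by
  obtain ⟨Cst, hCst, h⟩ := scalarLetters_cubic d ha'
  obtain ⟨C₀, hC₀, h0⟩ := sup_Gps d ha'
  -- one constant dominating both the letters' product and the zeroth letter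
  refine ⟨max (((d : ℝ) + 1) * a' * Cst ^ 2) (a' * C₀), lt_max_of_lt_left (by positivity), ?_⟩
  intro N R N₀ _ _ _ σ σ' hS hS' v V hv x
  have hN : 1 ≤ N := Nat.one_le_iff_ne_zero.mpr (NeZero.ne N)
  have hRN : 1 ≤ R * N := Nat.one_le_iff_ne_zero.mpr (NeZero.ne (R * N))
  have key := norm_Mhard_succ_sub_stair_le_of_letters N R (fun _ : Fin (d + 1) => N₀) ha'
    (B₁ := Cst * (1 + Real.log ((R * N : ℕ) : ℝ))) (B₂ := Cst) (C₁ := Cst) (C₂ := Cst * (1 + Real.log (N : ℝ))) (C₀ := C₀)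
    (σ := σ) (σ' := σ') (V := V)
    (fun μ g b hg x => ((h (R * N) N₀ hRN μ μ g b hg x).2.1))
    (fun μ g b hg x => ((h (R * N) N₀ hRN μ μ g b hg x).1))
    (fun μ f b hf z => ((h N N₀ hN μ μ f b hf z).2.2.1))
    (fun μ f b hf z => ((h N N₀ hN μ μ f b hf z).2.2.2))
    (fun f b hf z => h0 N (fun _ : Fin (d + 1) => N₀) f b hf z) hS hS' v hv x
  -- signs: σ′ ≥ 0 and V ≥ 0 from the hypotheses at the zero field ∕ at a site; σ ≥ 0 likewise
  have hV : 0 ≤ V := (norm_nonneg _).trans (hv 0)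
  have hσ : 0 ≤ σ := by
    have := hS (fun _ => (1 : ℂ)) 1 (fun _ => by simp) 0
    have h1 : (0 : ℝ) ≤ σ * 1 := (norm_nonneg _).trans this
    linarith
  have hσ' : 0 ≤ σ' := by
    have := hS' (fun _ => (1 : ℂ)) 1 (fun _ => by simp) 0
    have h1 : (0 : ℝ) ≤ σ' * 1 := (norm_nonneg _).trans this
    linarith
  have hR : 0 < R := Nat.pos_of_ne_zero (NeZero.ne R)
  have hR1 : (1 : ℝ) ≤ R := by exact_mod_cast hR
  have hρ : 0 ≤ ((R : ℝ) - 1) / ((R : ℝ) * N) := div_nonneg (by linarith) (by positivity)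
  have hlogRN : 0 ≤ Real.log ((R * N : ℕ) : ℝ) := Real.log_nonneg (by exact_mod_cast hRN)
  have hlogN : 0 ≤ Real.log (N : ℝ) := Real.log_nonneg (by exact_mod_cast hN)
  have hA : ((d : ℝ) + 1) * a' * Cst ^ 2 ≤ max (((d : ℝ) + 1) * a' * Cst ^ 2) (a' * C₀) := le_max_left _ _
  have hB : a' * C₀ ≤ max (((d : ℝ) + 1) * a' * Cst ^ 2) (a' * C₀) := le_max_right _ _
  set K := max (((d : ℝ) + 1) * a' * Cst ^ 2) (a' * C₀) with hK
  have hK0 : 0 ≤ K := le_trans (by positivity) hA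
  calc _ ≤ _ := key
    _ = (((d : ℝ) + 1) * a' * Cst ^ 2) * (((R : ℝ) - 1) / ((R : ℝ) * N)) * (2 + Real.log ((R * N : ℕ) : ℝ) + Real.log (N : ℝ))
          * σ' * (1 + (a' * C₀) * σ) * V := by push_cast; ring
    _ ≤ K * (((R : ℝ) - 1) / ((R : ℝ) * N)) * (2 + Real.log ((R * N : ℕ) : ℝ) + Real.log (N : ℝ)) * σ' * (1 + K * σ) * V := by
        have h2 : 0 ≤ (((R : ℝ) - 1) / ((R : ℝ) * N)) * (2 + Real.log ((R * N : ℕ) : ℝ) + Real.log (N : ℝ)) * σ' := by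
          positivity
        have h3 : (1 + (a' * C₀) * σ) ≤ (1 + K * σ) := by nlinarith
        have h4 : 0 ≤ 1 + (a' * C₀) * σ := by positivity
        calc (((d : ℝ) + 1) * a' * Cst ^ 2) * (((R : ℝ) - 1) / ((R : ℝ) * N)) * (2 + Real.log ((R * N : ℕ) : ℝ) + Real.log (N : ℝ))
              * σ' * (1 + (a' * C₀) * σ) * V
            = (((d : ℝ) + 1) * a' * Cst ^ 2) * (((((R : ℝ) - 1) / ((R : ℝ) * N)) * (2 + Real.log ((R * N : ℕ) : ℝ) + Real.log (N : ℝ))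
              * σ') * (1 + (a' * C₀) * σ) * V) := by ring
          _ ≤ K * (((((R : ℝ) - 1) / ((R : ℝ) * N)) * (2 + Real.log ((R * N : ℕ) : ℝ) + Real.log (N : ℝ)) * σ') * (1 + K * σ) * V) := by
              apply mul_le_mul hA _ (by positivity) hK0
              exact mul_le_mul_of_nonneg_right (mul_le_mul_of_nonneg_left h3 h2) hV
          _ = _ := by ring

/-! ## §2 (U-SINV) SUPPLIED — THE HARD LAWS ON CUBIC TORI WITH NO DISPLAYED BINDER, IN BOTH CURRENCIES (append, leaf seat
`b2b-balaban-gan24-formalise-leaf-03` gen 49; ref2 r205 items R205-1 (ii) ∕ R205-2)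

The two binders `σ, σ′` of §1 are the content of (U-SINV), delivered for EVERY torus by `SavgInverseUniform` (p259308 ∕ p259536:
`exists_sup_Savg_inv`, `rowDecay_Savg_inv_of_le`) and wired into road P2's two hard ENDs by `SavgInverseUniform` §5 ∕ `SavgInverseUniformHard`
(p260004).  Composing BY NAME: the SUP law from §1 + `exists_sup_Savg_inv` (`σ = σ′ = σ_∞(d,a′)`); the DECAY law from
`SavgInverseUniformHard.fieldDecay_Mhard_succ_sub_stair_uniform` + `ScalarSupLettersCubicHolds.scalarRowDecay_cubic` (letters `B₁ B₂ C₁ C₂` in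
`RowDecay` form, leaf-06 gen 35) + `ScalarZerothLetterTorus.rowDecay_Gps` (`C₀`), all transported to the common rate
`δ = min(δ_α, δ₀, deltaS d a′)` by `BlockFieldDecay.RowDecay.mono` (r205's «min-δ packaging»; no `Prop`-def).  The SOFT decay law and the
`S′ − S` kernel on cubic tori are leaf-06 gen 36's `MinimiserOneStepDecayCubic` (split of record, journal l.30172 ∕ l.30190).  HONEST: composition
only, 0 estimates here; scalar, `U = 1`, CUBIC; NOT the vector `H_k`, NOT (CONV-C) as typed, NEVER «G-an2-4 closed». -/

section Unconditional

open B5Action121 (sdiff)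
open B5Blocks16 (blockOf)
open B4Sect5Proof (latticeConst latticeConst_nonneg)
open B4TorusKernel.MultiPeriod (torusSupNorm)
open B6LowerBound2153Torus (rep)
open Summit.QuantumFields.BalabanUV.T4Continuum.ScalarAveragedPropagator (Gps)
open Summit.QuantumFields.BalabanUV.Beta.GAN24.StaircaseLaplacianDefect (stair)
open Summit.QuantumFields.BalabanUV.Beta.GAN24.BlockFieldDecay (RowDecay FieldDecay)
open Summit.QuantumFields.BalabanUV.Beta.GAN24.MinimiserOneStepDecay (epsSoft fieldDecay_single)
open Summit.QuantumFields.BalabanUV.Beta.GAN24.SavgInverseUniform (sigmaS deltaS sigmaS_pos deltaS_pos latticeConst_pos_of_pos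
  exists_sup_Savg_inv)
open Summit.QuantumFields.BalabanUV.Beta.GAN24.SavgInverseUniformHard (fieldDecay_Mhard_succ_sub_stair_uniform)
open Summit.QuantumFields.BalabanUV.Beta.GAN24.ScalarSupLettersCubicHolds (scalarRowDecay_cubic)
open Summit.QuantumFields.BalabanUV.Beta.GAN24.ScalarZerothLetterTorus (rowDecay_Gps)

/-- **THE ALL-SITES ONE-STEP SUP LAW OF THE HARD SCALAR MINIMISER ON CUBIC TORI, UNCONDITIONAL**: for every `a′ > 0` there is `C > 0`
(a function of `d, a′`) such that for all `N, R, N₀ ≥ 1`, all unit-lattice sources `v` with `|v| ≤ V` and every fine site `x′`,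
`‖(H_{RN}v)(x′) − (H_N v)(par x′)‖ ≤ C·((R−1)∕(RN))·(2 + log(RN) + log N)·V` — §1 with `σ = σ′ := σ_∞(d,a′)` of
`SavgInverseUniform.exists_sup_Savg_inv`, `C = C₁σ_∞(1 + C₁σ_∞)`. [folklore] -/
theorem norm_Mhard_succ_sub_stair_le_cubic {a' : ℝ} (ha' : 0 < a') :
    ∃ C : ℝ, 0 < C ∧ ∀ (N R N₀ : ℕ) [NeZero N] [NeZero R] [NeZero N₀]
      (v : Tor (fun _ : Fin (d + 1) => N₀) → ℂ) (V : ℝ), (∀ y, ‖v y‖ ≤ V) →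
        ∀ x : Tor (fine (R * N) (fun _ : Fin (d + 1) => N₀)),
          ‖(Mhard (R * N) (fun _ : Fin (d + 1) => N₀) a' *ᵥ v) x
              - (Mhard N (fun _ : Fin (d + 1) => N₀) a' *ᵥ v) (par N R (fun _ : Fin (d + 1) => N₀) x)‖
            ≤ C * (((R : ℝ) - 1) / ((R : ℝ) * N)) * (2 + Real.log ((R * N : ℕ) : ℝ) + Real.log (N : ℝ)) * V := by
  obtain ⟨C₁, hC₁, h⟩ := norm_Mhard_succ_sub_stair_le_cubic_of_sinv d ha'
  obtain ⟨σ, hσ, hS⟩ := exists_sup_Savg_inv d ha'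
  refine ⟨C₁ * σ * (1 + C₁ * σ), by positivity, fun N R N₀ _ _ _ v V hv x => ?_⟩
  have key := h N R N₀ σ σ (fun w b hw y => hS N (fun _ : Fin (d + 1) => N₀) w b hw y)
    (fun w b hw y => hS (R * N) (fun _ : Fin (d + 1) => N₀) w b hw y) v V hv x
  calc _ ≤ _ := key
    _ = C₁ * σ * (1 + C₁ * σ) * (((R : ℝ) - 1) / ((R : ℝ) * N)) * (2 + Real.log ((R * N : ℕ) : ℝ) + Real.log (N : ℝ)) * V := by
        ring

/-- **THE ONE-STEP DECAY LAW OF THE HARD SCALAR MINIMISER ON CUBIC TORI, UNCONDITIONAL**: for every `a′ > 0` there are `C, δ > 0` (functions of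
`d, a′`; `δ = min(δ_α, δ₀, δ_S)` of the three letter suppliers) such that for all `N, R, N₀ ≥ 1` and every unit-lattice source `v` decaying from `y′`
at rate `δ` with constant `V ≥ 0`, the one-step defect `H_{RN}v − J(H_N v)` decays from `y′` at rate `δ/32` with constant
`C·((R−1)∕(RN))·(2 + log(RN) + log N)·V` (conclusion shape = `MinimiserOneStepDecay.fieldDecay_Mhard_succ_sub_stair`). [folklore] -/
theorem fieldDecay_Mhard_succ_sub_stair_cubic {a' : ℝ} (ha' : 0 < a') :
    ∃ C δ : ℝ, 0 < C ∧ 0 < δ ∧ ∀ (N R N₀ : ℕ) [NeZero N] [NeZero R] [NeZero N₀]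
      (v : Tor (fun _ : Fin (d + 1) => N₀) → ℂ) (V : ℝ) (y' : Tor (fun _ : Fin (d + 1) => N₀)), 0 ≤ V →
        FieldDecay (fun _ : Fin (d + 1) => N₀) id v V δ y' →
        FieldDecay (fun _ : Fin (d + 1) => N₀) (blockOf (R * N) (fun _ : Fin (d + 1) => N₀))
          (Mhard (R * N) (fun _ : Fin (d + 1) => N₀) a' *ᵥ v
            - stair N R (fun _ : Fin (d + 1) => N₀) *ᵥ (Mhard N (fun _ : Fin (d + 1) => N₀) a' *ᵥ v))
          (C * (((R : ℝ) - 1) / ((R : ℝ) * N)) * (2 + Real.log ((R * N : ℕ) : ℝ) + Real.log (N : ℝ)) * V) (δ / 32) y' := by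
  obtain ⟨Cst, δα, hCst, hδα, hα⟩ := scalarRowDecay_cubic d ha'
  obtain ⟨δ₀, C₀, hδ₀, hC₀, h0⟩ := rowDecay_Gps d ha'
  set δ : ℝ := min δα (min δ₀ (deltaS d a')) with hδdef
  have hδ : 0 < δ := lt_min hδα (lt_min hδ₀ (deltaS_pos d ha'))
  have hδα' : δ ≤ δα := min_le_left _ _
  have hδ₀' : δ ≤ δ₀ := (min_le_right _ _).trans (min_le_left _ _)
  have hδS : δ ≤ deltaS d a' := (min_le_right _ _).trans (min_le_right _ _)
  have hσ := sigmaS_pos d ha'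
  have hK2 := latticeConst_pos_of_pos (Nat.succ_pos d) (a := δ / 2) (by positivity)
  have hK4 := latticeConst_pos_of_pos (Nat.succ_pos d) (a := δ / 2 / 2) (by positivity)
  have hK8 := latticeConst_pos_of_pos (Nat.succ_pos d) (a := δ / 2 / 4) (by positivity)
  have hK16 := latticeConst_pos_of_pos (Nat.succ_pos d) (a := δ / 16) (by positivity)
  have hK32 := latticeConst_pos_of_pos (Nat.succ_pos d) (a := δ / 32) (by positivity)
  refine ⟨((d : ℝ) + 1) * a' * Cst ^ 2 * latticeConst (d + 1) (δ / 2 / 2) * latticeConst (d + 1) (δ / 2 / 4)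
      * sigmaS d a' * latticeConst (d + 1) (δ / 2)
      * (1 + C₀ * a' * sigmaS d a' * latticeConst (d + 1) (δ / 16) * latticeConst (d + 1) (δ / 32)),
    δ, by positivity, hδ, ?_⟩
  intro N R N₀ _ _ _ v V y' hV hv
  have hN : 1 ≤ N := Nat.one_le_iff_ne_zero.mpr (NeZero.ne N)
  have hRN : 1 ≤ R * N := Nat.one_le_iff_ne_zero.mpr (NeZero.ne (R * N))
  have hR1 : (1 : ℝ) ≤ R := by exact_mod_cast Nat.one_le_iff_ne_zero.mpr (NeZero.ne R)
  have hρ : 0 ≤ ((R : ℝ) - 1) / ((R : ℝ) * N) := div_nonneg (by linarith) (by positivity)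
  have hlogN : 0 ≤ Real.log (N : ℝ) := Real.log_nonneg (by exact_mod_cast hN)
  have hlogRN : 0 ≤ Real.log ((R * N : ℕ) : ℝ) := Real.log_nonneg (by exact_mod_cast hRN)
  -- the seven letters at the common rate δ
  have hB₁ : ∀ μ : Fin (d + 1), RowDecay (fun _ : Fin (d + 1) => N₀) (blockOf (R * N) _) (blockOf (R * N) _)
      (Gps (R * N) (fun _ : Fin (d + 1) => N₀) a' * (sdiff (fine (R * N) (fun _ : Fin (d + 1) => N₀)) ((R * N : ℕ) : ℂ) μ)ᴴ
        * (sdiff (fine (R * N) (fun _ : Fin (d + 1) => N₀)) ((R * N : ℕ) : ℂ) μ)ᴴ) (Cst * (1 + Real.log ((R * N : ℕ) : ℝ))) δ := by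
    intro μ
    have h : RowDecay (fun _ : Fin (d + 1) => N₀) (blockOf (R * N) _) (blockOf (R * N) _)
        (Gps (R * N) (fun _ : Fin (d + 1) => N₀) a' * (sdiff (fine (R * N) (fun _ : Fin (d + 1) => N₀)) ((R * N : ℕ) : ℂ) μ)ᴴ
          * (sdiff (fine (R * N) (fun _ : Fin (d + 1) => N₀)) ((R * N : ℕ) : ℂ) μ)ᴴ) (Cst * (1 + Real.log ((R * N : ℕ) : ℝ))) δα := by
      intro x y''; exact (hα (R * N) N₀ hRN μ μ x y'').2.1
    exact h.mono le_rfl (by positivity) hδα'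
  have hB₂ : ∀ μ : Fin (d + 1), RowDecay (fun _ : Fin (d + 1) => N₀) (blockOf (R * N) _) (blockOf (R * N) _)
      (Gps (R * N) (fun _ : Fin (d + 1) => N₀) a' * (sdiff (fine (R * N) (fun _ : Fin (d + 1) => N₀)) ((R * N : ℕ) : ℂ) μ)ᴴ) Cst δ := by
    intro μ
    have h : RowDecay (fun _ : Fin (d + 1) => N₀) (blockOf (R * N) _) (blockOf (R * N) _)
        (Gps (R * N) (fun _ : Fin (d + 1) => N₀) a' * (sdiff (fine (R * N) (fun _ : Fin (d + 1) => N₀)) ((R * N : ℕ) : ℂ) μ)ᴴ) Cst δα := by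
      intro x y''; exact (hα (R * N) N₀ hRN μ μ x y'').1
    exact h.mono le_rfl hCst.le hδα'
  have hC₁ : ∀ μ : Fin (d + 1), RowDecay (fun _ : Fin (d + 1) => N₀) (blockOf N _) (blockOf N _)
      (sdiff (fine N (fun _ : Fin (d + 1) => N₀)) ((N : ℕ) : ℂ) μ * Gps N (fun _ : Fin (d + 1) => N₀) a') Cst δ := by
    intro μ
    have h : RowDecay (fun _ : Fin (d + 1) => N₀) (blockOf N _) (blockOf N _)
        (sdiff (fine N (fun _ : Fin (d + 1) => N₀)) ((N : ℕ) : ℂ) μ * Gps N (fun _ : Fin (d + 1) => N₀) a') Cst δα := by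
      intro x y''; exact (hα N N₀ hN μ μ x y'').2.2.1
    exact h.mono le_rfl hCst.le hδα'
  have hC₂ : ∀ μ : Fin (d + 1), RowDecay (fun _ : Fin (d + 1) => N₀) (blockOf N _) (blockOf N _)
      ((sdiff (fine N (fun _ : Fin (d + 1) => N₀)) ((N : ℕ) : ℂ) μ)ᴴ * sdiff (fine N (fun _ : Fin (d + 1) => N₀)) ((N : ℕ) : ℂ) μ
        * Gps N (fun _ : Fin (d + 1) => N₀) a') (Cst * (1 + Real.log (N : ℝ))) δ := by
    intro μ
    have h : RowDecay (fun _ : Fin (d + 1) => N₀) (blockOf N _) (blockOf N _)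
        ((sdiff (fine N (fun _ : Fin (d + 1) => N₀)) ((N : ℕ) : ℂ) μ)ᴴ * sdiff (fine N (fun _ : Fin (d + 1) => N₀)) ((N : ℕ) : ℂ) μ
          * Gps N (fun _ : Fin (d + 1) => N₀) a') (Cst * (1 + Real.log (N : ℝ))) δα := by
      intro x y''; exact (hα N N₀ hN μ μ x y'').2.2.2
    exact h.mono le_rfl (by positivity) hδα'
  have hC₀' : RowDecay (fun _ : Fin (d + 1) => N₀) (blockOf N _) (blockOf N _) (Gps N (fun _ : Fin (d + 1) => N₀) a') C₀ δ :=
    (h0 N (fun _ : Fin (d + 1) => N₀)).mono le_rfl hC₀.le hδ₀'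
  have key := fieldDecay_Mhard_succ_sub_stair_uniform N R (fun _ : Fin (d + 1) => N₀) ha' hδ hδS hB₁ hB₂ hC₁ hC₂ hC₀' hV hv
  refine key.mono (le_of_eq ?_) (by positivity) le_rfl
  unfold epsSoft
  push_cast
  ring

/-- **THE HARD MINIMISER'S ONE-STEP KERNEL ON CUBIC TORI, UNCONDITIONAL**: with `C, δ` of `fieldDecay_Mhard_succ_sub_stair_cubic`, for every unit
site `y′` and every fine site `x′`, `‖((H_{RN} − J·H_N)δ_{y′})(x′)‖ ≤ C·((R−1)∕(RN))·(2 + log(RN) + log N)·e^{−(δ/32)·|blockOf x′ − y′|_{T,∞}}`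
— the row's two-clause shape (rate AND decay) for the scalar H-type constituent. [folklore] -/
theorem norm_Mhard_succ_sub_stair_apply_le_cubic {a' : ℝ} (ha' : 0 < a') :
    ∃ C δ : ℝ, 0 < C ∧ 0 < δ ∧ ∀ (N R N₀ : ℕ) [NeZero N] [NeZero R] [NeZero N₀]
      (x : Tor (fine (R * N) (fun _ : Fin (d + 1) => N₀))) (y' : Tor (fun _ : Fin (d + 1) => N₀)),
        ‖(Mhard (R * N) (fun _ : Fin (d + 1) => N₀) a' *ᵥ Pi.single y' (1 : ℂ)
            - stair N R (fun _ : Fin (d + 1) => N₀) *ᵥ (Mhard N (fun _ : Fin (d + 1) => N₀) a' *ᵥ Pi.single y' (1 : ℂ))) x‖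
          ≤ C * (((R : ℝ) - 1) / ((R : ℝ) * N)) * (2 + Real.log ((R * N : ℕ) : ℝ) + Real.log (N : ℝ))
            * Real.exp (-(δ / 32 * torusSupNorm (fun _ : Fin (d + 1) => N₀)
                (rep (fun _ : Fin (d + 1) => N₀) (blockOf (R * N) (fun _ : Fin (d + 1) => N₀) x) - rep (fun _ : Fin (d + 1) => N₀) y'))) := by
  obtain ⟨C, δ, hC, hδ, h⟩ := fieldDecay_Mhard_succ_sub_stair_cubic d ha'
  refine ⟨C, δ, hC, hδ, fun N R N₀ _ _ _ x y' => ?_⟩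
  have key := h N R N₀ (Pi.single y' (1 : ℂ)) 1 y' zero_le_one (fieldDecay_single (M := fun _ : Fin (d + 1) => N₀) δ y') x
  rw [mul_one] at key
  exact key

end Unconditional

end Summit.QuantumFields.BalabanUV.Beta.GAN24.HardMinimiserOneStepCubic

end
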